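import Summits.QuantumFields.BalabanUV.Beta.CompositeVertexKernelLiftKernel
import Summits.QuantumFields.BalabanUV.Beta.CompositeVertexKernelBounds

/-!
# `BalabanUV.Beta.CompositeVertexKernelLiftContract` — row D1 ∕ (C1) OWNER an2 (gen 60), F6a‴: **THE TRANSPOSED LIFT IN `tsum` CURRENCY** — a SUMMABLE top covector
# contracted with F6a′'s upper lift equals its pull-back by the shifted composite linear kernel contracted with the slot function:
# `Σ'_y c y · liftUp ℓ L k F n μ y = Σ_κ Σ'_z (Σ'_y c y · compLinKer (ℓ∘(·+k+1)) L n (κ,z) (μ,y)) · F κ z` (one Fubini on `ℤ^{d+1} × ℤ^{d+1}`; bounded bricks,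
# bounded slot function, `0 < L`) — the `tsum` half of road FP's SPEC-48 (B4) «`liftUp`ᵀ» (the finite half is F6a″ `CompositeVertexKernelLiftKernel`, p408563 ✓)

WHAT ([folklore] `tsum` bookkeeping over OUR objects; 0 `def`, 0 `def … : Prop`, 0 sorry, nothing cited):
* §1 `card_winF`, `abs_pullback_term_le` (the termwise bound `|c y · compLinKer … · F κ z| ≤ |c y| · Cℓ^n · BF`), `summable_uncurry_pullback` (the family
  `(y, z) ↦ c y · compLinKer (ℓ∘(·+k+1)) L n (κ,z) (μ,y) · F κ z` is summable on the product — rows finitely supported in the window, row sums `≤ const·|c y|`),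
  the row ∕ column summabilities.
* §2 **`tsum_mul_liftUp_eq`** (the identity above), `abs_storeyVH_le`, and **`tsum_mul_compVHKer_eq`** (per storey: a summable top covector contracted with the composite vertex kernel =
  the pulled-back covector contracted with the storey brick — SPEC-48 (B4)'s `𝒢_k` with `λ′_k := Σ'_y c y · compLinKer (ℓ∘(·+k+1)) L (m−1−k) (·) (μ,y)`).
NOT HERE: the `SLam ∕ cwsum ∕ onLat` packaging of the road's Λ word (one unfolding away; the storey blocking's reading is the road's call).

HONEST FRAMING (cell charter, verbatim): «discharging `BetaPertH` makes Bałaban's UV stability UNCONDITIONAL — a real constructive-QFT result; it is NOT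
the continuum limit and NOT the Clay problem.»  THIS MODULE DISCHARGES NOTHING of row D1; no row of the END wrapper is touched; nothing of Bałaban's asserted.
NOT (C1), NOT D1, NEVER «G-an2-4 closed», NOT BetaPertH, NOT continuum, NOT Clay.
HONEST DEPENDENCY (verbatim): «continuum YM on T⁴ ⇐ BetaPertH ∧ nine spine estimates (0/9 proved); BetaPertH ⇐ (D1) ∧ (D4) ∧ CAP+tail;
G-an2-4 gates asym, D1 and NE2/3/4.»  ABSOLUTE RULE (cell, verbatim): «No internally-minted statement may enter as a cited fact. Every
hypothesis is either kernel-proved in this package or a verbatim quotation of a PUBLISHED theorem with page reference.»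
Unit `b2b-balaban-beta-an2` gen 60 (row-D1 owner), 2026-08-25; `bears_on: R4-O/T1|T1a` (bookkeeping toward the wrapper's `hHN₁`; moves no node counter).  No existing file touched.
-/

noncomputable section

namespace Summit.QuantumFields.BalabanUV.Beta.CompositeVertexKernelLiftContract

open Finset
open scoped BigOperators
open Literature.MathematicalPhysics.QuantumFieldTheory.Balaban1983to89.Beta
open AffineAveraging (Site)
open AveragingHessianKernels (Bond)
open Summit.QuantumFields.BalabanUV.Beta.CompositeVertexKernelRec (offs compLinKer compVHKer winF wid mem_winF_iff compLinKer_eq_zero abs_compLinKer_le)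
open Summit.QuantumFields.BalabanUV.Beta.CompositeVertexKernelUnroll (storeyVH liftUp)
open Summit.QuantumFields.BalabanUV.Beta.CompositeVertexKernelLiftKernel (liftUp_eq_sum_compLinKer compVHKer_unroll_kernel summable_of_mem_winF
  summable_mul_compLinKer_top)

variable {d : ℕ}
variable {ℓ : ℕ → Fin (d + 1) → Site (d + 1) → Bond (d + 1) → ℝ}
  {𝓋 : ℕ → Fin (d + 1) → Site (d + 1) → Bond (d + 1) → Bond (d + 1) → ℝ} {L : ℕ}

/-! ## §1 Summability of the pull-back family on the product lattice -/

/-- [folklore] The window `winF N W y` has `(W+1)^{d+1}` sites. -/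
theorem card_winF (N W : ℕ) (y : Site (d + 1)) : (winF N W y).card = (W + 1) ^ (d + 1) := by
  rw [winF, Fintype.card_piFinset]
  rw [Finset.prod_congr rfl fun i _ =>
    show (Finset.Icc ((N : ℤ) * y i) ((N : ℤ) * y i + (W : ℕ))).card = W + 1 by
      rw [Int.card_Icc]
      have h : (N : ℤ) * y i + (W : ℕ) + 1 - (N : ℤ) * y i = ((W + 1 : ℕ) : ℤ) := by push_cast; ring
      rw [h, Int.toNat_natCast]]
  rw [Finset.prod_const, Finset.card_univ, Fintype.card_fin]

variable {Bℓ BF : ℝ} {F : Fin (d + 1) → Site (d + 1) → ℝ}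

/-- [folklore] Termwise bound of the pull-back family: `|c y · compLinKer (ℓ∘(·+k+1)) L n (κ,z) (μ,y) · F κ z| ≤ |c y| · (Cℓ^n · BF)`, `Cℓ = (d+1)(2L)^{d+1}Bℓ`. -/
theorem abs_pullback_term_le (hB : 0 ≤ Bℓ) (hℓb : ∀ i μ y g, |ℓ i μ y g| ≤ Bℓ) (hF : ∀ κ z, |F κ z| ≤ BF)
    (k n : ℕ) (c : Site (d + 1) → ℝ) (κ μ : Fin (d + 1)) (y z : Site (d + 1)) :
    |c y * (compLinKer (fun i => ℓ (k + 1 + i)) L n (κ, z) (μ, y) * F κ z)|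
      ≤ |c y| * ((((d : ℝ) + 1) * (2 * (L : ℝ)) ^ (d + 1) * Bℓ) ^ n * BF) := by
  rw [abs_mul, abs_mul]
  refine mul_le_mul_of_nonneg_left ?_ (abs_nonneg _)
  exact mul_le_mul (abs_compLinKer_le (ℓ := fun i => ℓ (k + 1 + i)) (L := L) hB (fun m μ' y' f => hℓb _ μ' y' f) n _ _) (hF κ z)
    (abs_nonneg _) (pow_nonneg (by positivity) n)

/-- [folklore] **THE PULL-BACK FAMILY IS SUMMABLE ON THE PRODUCT LATTICE**: for a summable top weight `c`, bounded bricks and a bounded slot function,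
`(y, z) ↦ c y · compLinKer (ℓ∘(·+k+1)) L n (κ,z) (μ,y) · F κ z` is summable on `ℤ^{d+1} × ℤ^{d+1}` (rows finitely supported in the window `winF (L^n) (wid L n) y`,
row sums `≤ (wid+1)^{d+1} · Cℓ^n · BF · |c y|`). -/
theorem summable_uncurry_pullback (hB : 0 ≤ Bℓ) (hℓb : ∀ i μ y g, |ℓ i μ y g| ≤ Bℓ) (hF : ∀ κ z, |F κ z| ≤ BF) (k n : ℕ)
    {c : Site (d + 1) → ℝ} (hc : Summable c) (κ μ : Fin (d + 1)) :
    Summable (Function.uncurry fun y z => c y * (compLinKer (fun i => ℓ (k + 1 + i)) L n (κ, z) (μ, y) * F κ z)) := by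
  set C : ℝ := (((d : ℝ) + 1) * (2 * (L : ℝ)) ^ (d + 1) * Bℓ) ^ n * BF with hCdef
  set g : Site (d + 1) × Site (d + 1) → ℝ := fun p => if p.2 ∈ winF (L ^ n) (wid L n) p.1 then |c p.1| * C else 0 with hgdef
  have hC0 : 0 ≤ C := by
    have hBF : 0 ≤ BF := (abs_nonneg _).trans (hF κ 0)
    positivity
  have hg0 : ∀ p, 0 ≤ g p := fun p => by
    simp only [hgdef]
    split_ifs
    · positivity
    · exact le_rfl
  have hrow : ∀ y, ∑' z, g (y, z) = (((wid L n : ℝ) + 1) ^ (d + 1) * C) * |c y| := fun y => by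
    rw [tsum_eq_sum (s := winF (L ^ n) (wid L n) y) (fun z hz => by simp only [hgdef]; rw [if_neg hz])]
    rw [Finset.sum_congr rfl fun z hz => by simp only [hgdef]; rw [if_pos hz], Finset.sum_const, nsmul_eq_mul, card_winF]
    push_cast
    ring
  have hg : Summable g := by
    refine (summable_prod_of_nonneg hg0).2 ⟨fun y => ?_, ?_⟩
    · exact summable_of_ne_finset_zero (s := winF (L ^ n) (wid L n) y) fun z hz => by simp only [hgdef]; rw [if_neg hz]
    · simp_rw [hrow]
      exact hc.abs.mul_left _
  refine Summable.of_norm_bounded hg fun p => ?_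
  rcases p with ⟨y, z⟩
  simp only [Function.uncurry, Real.norm_eq_abs, hgdef]
  by_cases hz : z ∈ winF (L ^ n) (wid L n) y
  · rw [if_pos hz]
    exact abs_pullback_term_le hB hℓb hF k n c κ μ y z
  · rw [if_neg hz, compLinKer_eq_zero (ℓ := fun i => ℓ (k + 1 + i)) n (f := (κ, z)) (g := (μ, y)) hz, zero_mul, mul_zero, abs_zero]

/-! ## §2 The transposed lift and the contracted unrolling in `tsum` currency -/

/-- [folklore] **THE TRANSPOSED LIFT, `tsum` CURRENCY**: for a summable top weight `c` (bricks bounded, slot function bounded, `0 < L`),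
`Σ'_y c y · liftUp ℓ L k F n μ y = Σ_κ Σ'_z (Σ'_y c y · compLinKer (ℓ∘(·+k+1)) L n (κ, z) (μ, y)) · F κ z`. -/
theorem tsum_mul_liftUp_eq (hL : 0 < L) (hB : 0 ≤ Bℓ) (hℓb : ∀ i μ y g, |ℓ i μ y g| ≤ Bℓ) (hF : ∀ κ z, |F κ z| ≤ BF) (k n : ℕ)
    {c : Site (d + 1) → ℝ} (hc : Summable c) (μ : Fin (d + 1)) :
    ∑' y, c y * liftUp ℓ L k F n μ y
      = ∑ κ : Fin (d + 1), ∑' z, (∑' y, c y * compLinKer (fun i => ℓ (k + 1 + i)) L n (κ, z) (μ, y)) * F κ z := by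
  -- the lift as a finite window sum, then as a (finitely supported) `tsum` in `z`
  have h1 : ∀ y, c y * liftUp ℓ L k F n μ y
      = ∑ κ : Fin (d + 1), ∑' z, c y * (compLinKer (fun i => ℓ (k + 1 + i)) L n (κ, z) (μ, y) * F κ z) := fun y => by
    rw [liftUp_eq_sum_compLinKer, Finset.mul_sum]
    refine Finset.sum_congr rfl fun κ _ => ?_
    rw [Finset.mul_sum, tsum_eq_sum (s := winF (L ^ n) (wid L n) y) (fun z hz => by
      rw [compLinKer_eq_zero (ℓ := fun i => ℓ (k + 1 + i)) n (f := (κ, z)) (g := (μ, y)) hz, zero_mul, mul_zero])]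
  have hunc := fun κ => summable_uncurry_pullback (L := L) hB hℓb hF k n hc κ μ
  have hrowS : ∀ κ y, Summable fun z => c y * (compLinKer (fun i => ℓ (k + 1 + i)) L n (κ, z) (μ, y) * F κ z) := fun κ y =>
    summable_of_ne_finset_zero (s := winF (L ^ n) (wid L n) y) fun z hz => by
      rw [compLinKer_eq_zero (ℓ := fun i => ℓ (k + 1 + i)) n (f := (κ, z)) (g := (μ, y)) hz, zero_mul, mul_zero]
  have hcolS : ∀ κ z, Summable fun y => c y * (compLinKer (fun i => ℓ (k + 1 + i)) L n (κ, z) (μ, y) * F κ z) := fun κ z => by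
    have h := summable_mul_compLinKer_top (ℓ := ℓ) hL k n (fun y => c y * F κ z) κ μ z
    exact h.congr fun y => by ring
  have hprod : ∀ κ : Fin (d + 1), Summable fun y => ∑' z, c y * (compLinKer (fun i => ℓ (k + 1 + i)) L n (κ, z) (μ, y) * F κ z) :=
    fun κ => (hunc κ).prod
  rw [tsum_congr h1, Summable.tsum_finsetSum (fun κ _ => hprod κ)]
  refine Finset.sum_congr rfl fun κ _ => ?_
  have hsw : (∑' y, ∑' z, c y * (compLinKer (fun i => ℓ (k + 1 + i)) L n (κ, z) (μ, y) * F κ z))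
      = ∑' z, ∑' y, c y * (compLinKer (fun i => ℓ (k + 1 + i)) L n (κ, z) (μ, y) * F κ z) :=
    ((hunc κ).tsum_comm' (hrowS κ) (hcolS κ)).symm
  rw [hsw]
  refine tsum_congr fun z => ?_
  rw [← tsum_mul_right]
  exact tsum_congr fun y => by ring

/-- [folklore] Bound on the storey brick: `|storeyVH ℓ 𝓋 L k σ f f′| ≤ ((d+1)(2L)^{d+1})² · B𝓋 · Cℓ^{2k}`. -/
theorem abs_storeyVH_le (hB : 0 ≤ Bℓ) (hℓb : ∀ i μ y g, |ℓ i μ y g| ≤ Bℓ) {B𝓋 : ℝ} (hB𝓋 : 0 ≤ B𝓋)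
    (h𝓋b : ∀ i μ y g g', |𝓋 i μ y g g'| ≤ B𝓋) (k : ℕ) (μ : Fin (d + 1)) (y : Site (d + 1)) (f f' : Bond (d + 1)) :
    |storeyVH ℓ 𝓋 L k μ y f f'|
      ≤ (((d : ℝ) + 1) * (2 * (L : ℝ)) ^ (d + 1)) ^ 2 * B𝓋 * ((((d : ℝ) + 1) * (2 * (L : ℝ)) ^ (d + 1) * Bℓ) ^ k) ^ 2 := by
  set C := ((d : ℝ) + 1) * (2 * (L : ℝ)) ^ (d + 1) * Bℓ with hC
  have hCk : 0 ≤ C ^ k := pow_nonneg (by positivity) k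
  have hterm : ∀ (κ : Fin (d + 1)) (e : Site (d + 1)) (κ' : Fin (d + 1)) (e' : Site (d + 1)),
      |𝓋 k μ y (κ, (L : ℤ) • y + e) (κ', (L : ℤ) • y + e')
          * compLinKer ℓ L k f (κ, (L : ℤ) • y + e) * compLinKer ℓ L k f' (κ', (L : ℤ) • y + e')| ≤ B𝓋 * C ^ k * C ^ k := by
    intro κ e κ' e'
    rw [abs_mul, abs_mul]
    exact mul_le_mul (mul_le_mul (h𝓋b _ _ _ _ _) (abs_compLinKer_le (ℓ := ℓ) (L := L) hB hℓb k _ _) (abs_nonneg _) hB𝓋)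
      (abs_compLinKer_le (ℓ := ℓ) (L := L) hB hℓb k _ _) (abs_nonneg _) (mul_nonneg hB𝓋 hCk)
  unfold storeyVH
  calc |∑ κ : Fin (d + 1), ∑ e ∈ offs L, ∑ κ' : Fin (d + 1), ∑ e' ∈ offs L,
          𝓋 k μ y (κ, (L : ℤ) • y + e) (κ', (L : ℤ) • y + e')
            * compLinKer ℓ L k f (κ, (L : ℤ) • y + e) * compLinKer ℓ L k f' (κ', (L : ℤ) • y + e')|
      ≤ ∑ κ : Fin (d + 1), ∑ e ∈ offs L, ∑ κ' : Fin (d + 1), ∑ e' ∈ offs L, B𝓋 * C ^ k * C ^ k := by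
        refine (Finset.abs_sum_le_sum_abs _ _).trans (Finset.sum_le_sum fun κ _ => ?_)
        refine (Finset.abs_sum_le_sum_abs _ _).trans (Finset.sum_le_sum fun e _ => ?_)
        refine (Finset.abs_sum_le_sum_abs _ _).trans (Finset.sum_le_sum fun κ' _ => ?_)
        exact (Finset.abs_sum_le_sum_abs _ _).trans (Finset.sum_le_sum fun e' _ => hterm κ e κ' e')
    _ = (((d : ℝ) + 1) * (2 * (L : ℝ)) ^ (d + 1)) ^ 2 * B𝓋 * (C ^ k) ^ 2 := by
        simp only [Finset.sum_const, Finset.card_univ, Fintype.card_fin, nsmul_eq_mul,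
          Summit.QuantumFields.BalabanUV.Beta.CompositeVertexKernelRec.card_offs]
        push_cast
        ring

/-- [folklore] **THE CONTRACTED UNROLLING, `tsum` CURRENCY** (SPEC-48 (B4)): for a summable top weight `c`, bounded bricks `ℓ`, `𝓋` and `0 < L`,
`Σ'_y c y · compVHKer ℓ 𝓋 L m μ y f f′ = Σ_{k<m} Σ_κ Σ'_z (Σ'_y c y · compLinKer (ℓ∘(·+k+1)) L (m−1−k) (κ,z) (μ,y)) · storeyVH ℓ 𝓋 L k κ z f f′` — per storey the
pulled-back covector `λ′_k` contracted with the storey brick. -/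
theorem tsum_mul_compVHKer_eq (hL : 0 < L) (hB : 0 ≤ Bℓ) (hℓb : ∀ i μ y g, |ℓ i μ y g| ≤ Bℓ) {B𝓋 : ℝ} (hB𝓋 : 0 ≤ B𝓋)
    (h𝓋b : ∀ i μ y g g', |𝓋 i μ y g g'| ≤ B𝓋) (m : ℕ) {c : Site (d + 1) → ℝ} (hc : Summable c) (μ : Fin (d + 1)) (f f' : Bond (d + 1)) :
    ∑' y, c y * compVHKer ℓ 𝓋 L m μ y f f'
      = ∑ k ∈ range m, ∑ κ : Fin (d + 1), ∑' z,
          (∑' y, c y * compLinKer (fun i => ℓ (k + 1 + i)) L (m - 1 - k) (κ, z) (μ, y)) * storeyVH ℓ 𝓋 L k κ z f f' := by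
  -- each storey's slot function is bounded, so each storey's contraction converges and part `tsum_mul_liftUp_eq` applies
  have hF : ∀ k : ℕ, ∀ κ z, |storeyVH ℓ 𝓋 L k κ z f f'|
      ≤ (((d : ℝ) + 1) * (2 * (L : ℝ)) ^ (d + 1)) ^ 2 * B𝓋 * ((((d : ℝ) + 1) * (2 * (L : ℝ)) ^ (d + 1) * Bℓ) ^ k) ^ 2 :=
    fun k κ z => abs_storeyVH_le hB hℓb hB𝓋 h𝓋b k κ z f f'
  -- summability of each storey's contraction `y ↦ c y · liftUp …`: the lift of a bounded slot function is bounded (finite window sum of bounded terms)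
  have hlift : ∀ k : ℕ, Summable fun y => c y * liftUp ℓ L k (fun μ' y' => storeyVH ℓ 𝓋 L k μ' y' f f') (m - 1 - k) μ y := by
    intro k
    set n := m - 1 - k
    set BF := (((d : ℝ) + 1) * (2 * (L : ℝ)) ^ (d + 1)) ^ 2 * B𝓋 * ((((d : ℝ) + 1) * (2 * (L : ℝ)) ^ (d + 1) * Bℓ) ^ k) ^ 2
    set Cn := (((d : ℝ) + 1) * (2 * (L : ℝ)) ^ (d + 1) * Bℓ) ^ n
    have hBF : 0 ≤ BF := (abs_nonneg _).trans (hF k 0 0)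
    have hb : ∀ y, |liftUp ℓ L k (fun μ' y' => storeyVH ℓ 𝓋 L k μ' y' f f') n μ y|
        ≤ ((d : ℝ) + 1) * (((wid L n : ℝ) + 1) ^ (d + 1)) * (Cn * BF) := by
      intro y
      rw [liftUp_eq_sum_compLinKer]
      calc |∑ κ : Fin (d + 1), ∑ z ∈ winF (L ^ n) (wid L n) y,
              compLinKer (fun i => ℓ (k + 1 + i)) L n (κ, z) (μ, y) * storeyVH ℓ 𝓋 L k κ z f f'|
          ≤ ∑ κ : Fin (d + 1), ∑ z ∈ winF (L ^ n) (wid L n) y, Cn * BF := by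
            refine (Finset.abs_sum_le_sum_abs _ _).trans (Finset.sum_le_sum fun κ _ => ?_)
            refine (Finset.abs_sum_le_sum_abs _ _).trans (Finset.sum_le_sum fun z _ => ?_)
            rw [abs_mul]
            exact mul_le_mul (abs_compLinKer_le (ℓ := fun i => ℓ (k + 1 + i)) (L := L) hB (fun m' μ' y' g => hℓb _ μ' y' g) n _ _)
              (hF k κ z) (abs_nonneg _) (pow_nonneg (by positivity) n)
        _ = ((d : ℝ) + 1) * (((wid L n : ℝ) + 1) ^ (d + 1)) * (Cn * BF) := by
            rw [Finset.sum_const, Finset.sum_const, Finset.card_univ, Fintype.card_fin, nsmul_eq_mul, nsmul_eq_mul, card_winF]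
            push_cast
            ring
    exact KKTFluctuationEnergy.summable_mul_of_bdd' hc hb
  calc ∑' y, c y * compVHKer ℓ 𝓋 L m μ y f f'
      = ∑' y, ∑ k ∈ range m, c y * liftUp ℓ L k (fun μ' y' => storeyVH ℓ 𝓋 L k μ' y' f f') (m - 1 - k) μ y := by
        refine tsum_congr fun y => ?_
        rw [Summit.QuantumFields.BalabanUV.Beta.CompositeVertexKernelUnroll.compVHKer_unroll, Finset.mul_sum]
    _ = ∑ k ∈ range m, ∑' y, c y * liftUp ℓ L k (fun μ' y' => storeyVH ℓ 𝓋 L k μ' y' f f') (m - 1 - k) μ y :=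
        Summable.tsum_finsetSum fun k _ => hlift k
    _ = ∑ k ∈ range m, ∑ κ : Fin (d + 1), ∑' z,
          (∑' y, c y * compLinKer (fun i => ℓ (k + 1 + i)) L (m - 1 - k) (κ, z) (μ, y)) * storeyVH ℓ 𝓋 L k κ z f f' :=
        Finset.sum_congr rfl fun k _ => tsum_mul_liftUp_eq hL hB hℓb (hF k) k (m - 1 - k) hc μ

end Summit.QuantumFields.BalabanUV.Beta.CompositeVertexKernelLiftContract

end
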